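import Summits.HodgeConjecture.HodgeConjecture.Theorems.HodgeLocusCensusPlaneSumStackRank4
import Summits.HodgeConjecture.HodgeConjecture.Theorems.HodgeLocusCensusPlaneSumStackRank6
import Summits.HodgeConjecture.HodgeConjecture.Theorems.HodgeLocusCensusPlaneSumStackRank8
import Summits.HodgeConjecture.HodgeConjecture.Theorems.HodgeLocusCensusPlaneSumStackCerts
import HarnessLib

/-!
# HodgeLocusCensusPlaneSumStackCells — PROVED: the six STACKED-RANK census rows rank [M_Z ; M_{Π′}] = 17 / 54 / 120 and rank [M_Z ; M_{Z′}] = 15 / 44 / 96 on X⁴_{4,6,8} (cell pub-hlocus, LEAD gen 5, (T37))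
HONEST FRAMING: certified instances and evidence bearing on the general Hodge conjecture; no claim.

Corollaries of `ivhsStackRankEq_of_cert{4,6,8}` (`HodgeLocusCensusPlaneSumStackRank{4,6,8}`) and the kernel-checked stacked certificates
(`HodgeLocusCensusPlaneSumStackCerts`): the typed rows `GrSection.stackRank_{4,6,8}_4` (rank [M_Z ; M_{Π′}] = 17, 54, 120: the codimension
of T_Z ∩ T_{Π′}, records R33 / engine B) and `TwistCells.stackRankZZprime_{4,6,8}_4` (rank [M_Z ; M_{Z′}] = 15, 44, 96: codimension of
T_Z ∩ T_{Z′}, records R30 / R31 / engine B) HOLD over every field of characteristic 0 and every primitive 8th root of unity. What is proved is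
exactly the typed first-order statement; the census commentary attached to these numbers (T₀ of the twist cells, (C1)) is a record of the cell.
-/

namespace Summit.HodgeConjecture.HodgeConjecture.HodgeLocus.Census.PlaneSum

open TwistCells GrSection

/-! ## stacked pair `stackZPiPrime` -/

/-- the top layer of `GrSection.stackRank_4_4` is the plane list of `stackZPiPrimeL1` … -/
theorem stackZPiPrime_top_list4 : fourPlanes4 = planeList4 stackZPiPrimeL1 := by
  simp [fourPlanes4, planeList4, stackZPiPrimeL1]
/-- … and the bottom layer is the plane list of `stackZPiPrimeL2`. -/
theorem stackZPiPrime_bot_list4 : ([(1, piPrime4)] : List (ℚ × LinearCycle 4)) = planeList4 stackZPiPrimeL2 := by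
  simp [piPrime4, planeList4, stackZPiPrimeL2]

/-- PROVED ROW: `GrSection.stackRank_4_4` — rank [M₁ ; M₂] = 17. -/
theorem stackRank_4_4_holds : GrSection.stackRank_4_4 := by
  unfold GrSection.stackRank_4_4
  rw [stackZPiPrime_top_list4, stackZPiPrime_bot_list4]
  exact ivhsStackRankEq_of_cert4 stackZPiPrimeL1 stackZPiPrimeL2 stackZPiPrimeCert stackZPiPrime_valid stackZPiPrimeModeK4 stackZPiPrimeOff4 stackZPiPrime_H1_4 stackZPiPrime_H2_4 stackZPiPrime_H3_4

/-- the top layer of `GrSection.stackRank_6_4` is the plane list of `stackZPiPrimeL1` … -/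
theorem stackZPiPrime_top_list6 : fourPlanes6 = planeList6 stackZPiPrimeL1 := by
  simp [fourPlanes6, planeList6, stackZPiPrimeL1]
/-- … and the bottom layer is the plane list of `stackZPiPrimeL2`. -/
theorem stackZPiPrime_bot_list6 : ([(1, piPrime6)] : List (ℚ × LinearCycle 6)) = planeList6 stackZPiPrimeL2 := by
  simp [piPrime6, planeList6, stackZPiPrimeL2]

/-- PROVED ROW: `GrSection.stackRank_6_4` — rank [M₁ ; M₂] = 54. -/
theorem stackRank_6_4_holds : GrSection.stackRank_6_4 := by
  unfold GrSection.stackRank_6_4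
  rw [stackZPiPrime_top_list6, stackZPiPrime_bot_list6]
  exact ivhsStackRankEq_of_cert6 stackZPiPrimeL1 stackZPiPrimeL2 stackZPiPrimeCert stackZPiPrime_valid stackZPiPrimeModeK6 stackZPiPrimeOff6 stackZPiPrime_H1_6 stackZPiPrime_H2_6 stackZPiPrime_H3_6

/-- the top layer of `GrSection.stackRank_8_4` is the plane list of `stackZPiPrimeL1` … -/
theorem stackZPiPrime_top_list8 : fourPlanes8 = planeList8 stackZPiPrimeL1 := by
  simp [fourPlanes8, planeList8, stackZPiPrimeL1]
/-- … and the bottom layer is the plane list of `stackZPiPrimeL2`. -/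
theorem stackZPiPrime_bot_list8 : ([(1, piPrime8)] : List (ℚ × LinearCycle 8)) = planeList8 stackZPiPrimeL2 := by
  simp [piPrime8, planeList8, stackZPiPrimeL2]

/-- PROVED ROW: `GrSection.stackRank_8_4` — rank [M₁ ; M₂] = 120. -/
theorem stackRank_8_4_holds : GrSection.stackRank_8_4 := by
  unfold GrSection.stackRank_8_4
  rw [stackZPiPrime_top_list8, stackZPiPrime_bot_list8]
  exact ivhsStackRankEq_of_cert8 stackZPiPrimeL1 stackZPiPrimeL2 stackZPiPrimeCert stackZPiPrime_valid stackZPiPrimeModeK8 stackZPiPrimeOff8 stackZPiPrime_H1_8 stackZPiPrime_H2_8 stackZPiPrime_H3_8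

/-! ## stacked pair `stackZZprime` -/

/-- the top layer of `TwistCells.stackRankZZprime_4_4` is the plane list of `stackZZprimeL1` … -/
theorem stackZZprime_top_list4 : fourPlanes4 = planeList4 stackZZprimeL1 := by
  simp [fourPlanes4, planeList4, stackZZprimeL1]
/-- … and the bottom layer is the plane list of `stackZZprimeL2`. -/
theorem stackZZprime_bot_list4 : (twistedFourPlanes4 : List (ℚ × LinearCycle 4)) = planeList4 stackZZprimeL2 := by
  simp [twistedFourPlanes4, planeList4, stackZZprimeL2]

/-- PROVED ROW: `TwistCells.stackRankZZprime_4_4` — rank [M₁ ; M₂] = 15. -/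
theorem stackRankZZprime_4_4_holds : TwistCells.stackRankZZprime_4_4 := by
  unfold TwistCells.stackRankZZprime_4_4
  rw [stackZZprime_top_list4, stackZZprime_bot_list4]
  exact ivhsStackRankEq_of_cert4 stackZZprimeL1 stackZZprimeL2 stackZZprimeCert stackZZprime_valid stackZZprimeModeK4 stackZZprimeOff4 stackZZprime_H1_4 stackZZprime_H2_4 stackZZprime_H3_4

/-- the top layer of `TwistCells.stackRankZZprime_6_4` is the plane list of `stackZZprimeL1` … -/
theorem stackZZprime_top_list6 : fourPlanes6 = planeList6 stackZZprimeL1 := by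
  simp [fourPlanes6, planeList6, stackZZprimeL1]
/-- … and the bottom layer is the plane list of `stackZZprimeL2`. -/
theorem stackZZprime_bot_list6 : (twistedFourPlanes6 : List (ℚ × LinearCycle 6)) = planeList6 stackZZprimeL2 := by
  simp [twistedFourPlanes6, planeList6, stackZZprimeL2]

/-- PROVED ROW: `TwistCells.stackRankZZprime_6_4` — rank [M₁ ; M₂] = 44. -/
theorem stackRankZZprime_6_4_holds : TwistCells.stackRankZZprime_6_4 := by
  unfold TwistCells.stackRankZZprime_6_4
  rw [stackZZprime_top_list6, stackZZprime_bot_list6]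
  exact ivhsStackRankEq_of_cert6 stackZZprimeL1 stackZZprimeL2 stackZZprimeCert stackZZprime_valid stackZZprimeModeK6 stackZZprimeOff6 stackZZprime_H1_6 stackZZprime_H2_6 stackZZprime_H3_6

/-- the top layer of `TwistCells.stackRankZZprime_8_4` is the plane list of `stackZZprimeL1` … -/
theorem stackZZprime_top_list8 : fourPlanes8 = planeList8 stackZZprimeL1 := by
  simp [fourPlanes8, planeList8, stackZZprimeL1]
/-- … and the bottom layer is the plane list of `stackZZprimeL2`. -/
theorem stackZZprime_bot_list8 : (twistedFourPlanes8 : List (ℚ × LinearCycle 8)) = planeList8 stackZZprimeL2 := by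
  simp [twistedFourPlanes8, planeList8, stackZZprimeL2]

/-- PROVED ROW: `TwistCells.stackRankZZprime_8_4` — rank [M₁ ; M₂] = 96. -/
theorem stackRankZZprime_8_4_holds : TwistCells.stackRankZZprime_8_4 := by
  unfold TwistCells.stackRankZZprime_8_4
  rw [stackZZprime_top_list8, stackZZprime_bot_list8]
  exact ivhsStackRankEq_of_cert8 stackZZprimeL1 stackZZprimeL2 stackZZprimeCert stackZZprime_valid stackZZprimeModeK8 stackZZprimeOff8 stackZZprime_H1_8 stackZZprime_H2_8 stackZZprime_H3_8

end Summit.HodgeConjecture.HodgeConjecture.HodgeLocus.Census.PlaneSum
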